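import Mathlib
import HarnessLib
import Literature.MathematicalPhysics.QuantumLattice.SliceCutoffGramConstant
import Summits.HubbardSuperconductivity.HubbardSuperconductivity.Theorems.KLProgrammeSalmhoferCutoffDerivBound
import Summits.HubbardSuperconductivity.HubbardSuperconductivity.Theorems.KLProgrammeKLRegimeSplitThermalLayerExt

/-!
# Route `KLProgramme` — crux K3 split, ENGINE child (`KLRegimeEngineV11` stmt-HubbardSuperconductivity-19823): THE CARRIER'S SLICE WEIGHT meets the
# hypotheses of the `(k₀, e)`-plane estimates — `w_n(s) = χ₂(s/Λ_n²) − χ₂(s/(4Λ_n)²)` is bounded by `1`, `(17e²/2)/Λ_n²`-Lipschitz in `s`, and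
# vanishes for `s ≤ (Λ_n/2)²` and for `s ≥ (4Λ_n)²` (cell gate-hubbard-kl, seat hubbard-kl-k3c2-p2 «thermal-bar induction n ≤ nScales β + 1»)

The slice-`n` covariance `C^K_{(Λ_n, Λ_{n−1}]}` of the carrier (`hubbardCovSliceCT`, weight `hubbardCutoffWeightCT … Λ k = χ₂((ω² + e_K²)/Λ²)`) carries, as a
function of `s = ω² + e_K²`, the weight `w_n(s) = χ₂(s/Λ_n²) − χ₂(s/Λ_{n−1}²)` with `Λ_{n−1} = 4Λ_n` (`klth_klScale_succ`).  Every estimate of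
`…MatsubaraSlice*`, `…ThermalLayerExt` §4 is stated for an abstract weight `f : ℝ → ℂ` with hypotheses (`‖f‖ ≤ M_f`, `L_f`-Lipschitz with
`L_f ≤ ℓ/Λ_n²`, `f = 0` for `s ≤ (Λ_n/2)²` and for `s ≥ (4Λ_n)²`).  This module discharges them for `f = w_n` (as a `ℂ`-valued function) with the
EXPLICIT constants `M_f = 1`, `ℓ = 17e²/2 < 63` (`|χ₂′| ≤ 8e²`, `…KLProgrammeSalmhoferCutoffDerivBound`; k3c4-p1's support lemmas `sliceCutoff_eq_zero_of_le/ge`,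
`abs_sliceCutoff_le_one`): `klwt_norm_le`, `klwt_lipschitz`, `klwt_lipschitz_scale`, `klwt_zero_of_le`, `klwt_zero_of_ge`.  Pure analysis.
-/

noncomputable section

namespace Summit.HubbardSuperconductivity.HubbardSuperconductivity.Theorems.KLRegimeSplit

set_option linter.dupNamespace false -- summit = problem name (single-conjunct summit), D-0017

open Real Literature.MathematicalPhysics.QuantumLattice Literature.Probability.LatticeModels
open Summit.HubbardSuperconductivity.HubbardSuperconductivity.Theorems.KLProgrammeLegKernels

/-- **`‖w‖ ≤ 1`**: the complexified slice weight `s ↦ χ₂(s/Λ²) − χ₂(s/Λ′²)` is bounded by one. -/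
theorem klwt_norm_le (Λ Λ' s : ℝ) : ‖((salmhoferCutoff (s / Λ ^ 2) - salmhoferCutoff (s / Λ' ^ 2) : ℝ) : ℂ)‖ ≤ 1 := by
  rw [Complex.norm_real, Real.norm_eq_abs]
  exact abs_sliceCutoff_le_one s Λ Λ'

/-- **Lipschitz in `s`**: `‖w(s) − w(s')‖ ≤ 8e²·(1/Λ² + 1/Λ′²)·|s − s'|` (`|χ₂′| ≤ 8e²`). -/
theorem klwt_lipschitz {Λ Λ' : ℝ} (hΛ : Λ ≠ 0) (hΛ' : Λ' ≠ 0) (s s' : ℝ) :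
    ‖((salmhoferCutoff (s / Λ ^ 2) - salmhoferCutoff (s / Λ' ^ 2) : ℝ) : ℂ) -
        ((salmhoferCutoff (s' / Λ ^ 2) - salmhoferCutoff (s' / Λ' ^ 2) : ℝ) : ℂ)‖ ≤
      8 * Real.exp 2 * ((Λ ^ 2)⁻¹ + (Λ' ^ 2)⁻¹) * |s - s'| := by
  rw [← Complex.ofReal_sub, Complex.norm_real, Real.norm_eq_abs]
  have h1 := klcd_lipschitz_salmhoferCutoff_explicit (s / Λ ^ 2) (s' / Λ ^ 2)
  have h2 := klcd_lipschitz_salmhoferCutoff_explicit (s / Λ' ^ 2) (s' / Λ' ^ 2)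
  have hΛ2 : 0 < Λ ^ 2 := by positivity
  have hΛ'2 : 0 < Λ' ^ 2 := by positivity
  have e1 : |s / Λ ^ 2 - s' / Λ ^ 2| = (Λ ^ 2)⁻¹ * |s - s'| := by
    rw [← sub_div, abs_div, abs_of_pos hΛ2]; ring
  have e2 : |s / Λ' ^ 2 - s' / Λ' ^ 2| = (Λ' ^ 2)⁻¹ * |s - s'| := by
    rw [← sub_div, abs_div, abs_of_pos hΛ'2]; ring
  rw [e1] at h1
  rw [e2] at h2
  calc |salmhoferCutoff (s / Λ ^ 2) - salmhoferCutoff (s / Λ' ^ 2) - (salmhoferCutoff (s' / Λ ^ 2) - salmhoferCutoff (s' / Λ' ^ 2))|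
      = |(salmhoferCutoff (s / Λ ^ 2) - salmhoferCutoff (s' / Λ ^ 2)) - (salmhoferCutoff (s / Λ' ^ 2) - salmhoferCutoff (s' / Λ' ^ 2))| := by
        ring_nf
    _ ≤ |salmhoferCutoff (s / Λ ^ 2) - salmhoferCutoff (s' / Λ ^ 2)| + |salmhoferCutoff (s / Λ' ^ 2) - salmhoferCutoff (s' / Λ' ^ 2)| :=
        abs_sub _ _
    _ ≤ 8 * Real.exp 2 * ((Λ ^ 2)⁻¹ * |s - s'|) + 8 * Real.exp 2 * ((Λ' ^ 2)⁻¹ * |s - s'|) := add_le_add h1 h2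
    _ = 8 * Real.exp 2 * ((Λ ^ 2)⁻¹ + (Λ' ^ 2)⁻¹) * |s - s'| := by ring

/-- **Scale form of the Lipschitz constant**: for the slice `(Λ_n, Λ_{n−1}] = (Λ, 4Λ]`, `‖w(s) − w(s')‖ ≤ ((17e²/2)/Λ²)·|s − s'|` — i.e. the hypothesis
`L_f ≤ ℓ/Λ_n²` of the `(k₀,e)`-plane estimates holds with `ℓ = 17e²/2 (< 63)`. -/
theorem klwt_lipschitz_scale {Λ : ℝ} (hΛ : 0 < Λ) (s s' : ℝ) :
    ‖((salmhoferCutoff (s / Λ ^ 2) - salmhoferCutoff (s / (4 * Λ) ^ 2) : ℝ) : ℂ) -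
        ((salmhoferCutoff (s' / Λ ^ 2) - salmhoferCutoff (s' / (4 * Λ) ^ 2) : ℝ) : ℂ)‖ ≤
      (17 * Real.exp 2 / 2) / Λ ^ 2 * |s - s'| := by
  have h := klwt_lipschitz hΛ.ne' (by positivity : (4 * Λ) ≠ 0) s s'
  refine h.trans (le_of_eq ?_)
  field_simp
  ring

/-- `ℓ = 17e²/2 < 63`. -/
theorem klwt_ell_lt : 17 * Real.exp 2 / 2 < 63 := by
  have he : Real.exp 1 < 2.7182818286 := Real.exp_one_lt_d9
  have he0 : 0 < Real.exp 1 := Real.exp_pos 1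
  have h2 : Real.exp 2 = Real.exp 1 * Real.exp 1 := by rw [← Real.exp_add]; norm_num
  nlinarith

/-- **Inner support**: `w(s) = 0` for `s ≤ (Λ/2)²` (`0 < Λ`). -/
theorem klwt_zero_of_le {Λ : ℝ} (hΛ : 0 < Λ) (s : ℝ) (hs : s ≤ (Λ / 2) ^ 2) :
    ((salmhoferCutoff (s / Λ ^ 2) - salmhoferCutoff (s / (4 * Λ) ^ 2) : ℝ) : ℂ) = 0 := by
  rw [sliceCutoff_eq_zero_of_le hΛ (by linarith) (by rw [div_pow] at hs; linarith), Complex.ofReal_zero]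

/-- **Outer support**: `w(s) = 0` for `s ≥ (4Λ)²` (`0 < Λ`). -/
theorem klwt_zero_of_ge {Λ : ℝ} (hΛ : 0 < Λ) (s : ℝ) (hs : (4 * Λ) ^ 2 ≤ s) :
    ((salmhoferCutoff (s / Λ ^ 2) - salmhoferCutoff (s / (4 * Λ) ^ 2) : ℝ) : ℂ) = 0 := by
  rw [sliceCutoff_eq_zero_of_ge hΛ (by linarith) hs, Complex.ofReal_zero]

/-- **At scale `n ≥ 1` of the ladder** (`Λ = Λ_n`, `Λ′ = Λ_{n−1} = 4Λ_n`): the carrier's slice weight `s ↦ χ₂(s/Λ_n²) − χ₂(s/Λ_{n−1}²)` meets the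
four weight hypotheses of `klte_slice_bubble_weighted_norm_le` / `klsp_slice_bubble_shift_norm_le` with `M_f = 1`, `ℓ = 17e²/2`. -/
theorem klwt_sliceWeight_hypotheses {n : ℕ} (hn : 1 ≤ n) :
    (∀ s, ‖((salmhoferCutoff (s / klScale klE0 n ^ 2) - salmhoferCutoff (s / klScale klE0 (n - 1) ^ 2) : ℝ) : ℂ)‖ ≤ 1) ∧
    (∀ s s', ‖((salmhoferCutoff (s / klScale klE0 n ^ 2) - salmhoferCutoff (s / klScale klE0 (n - 1) ^ 2) : ℝ) : ℂ) -
        ((salmhoferCutoff (s' / klScale klE0 n ^ 2) - salmhoferCutoff (s' / klScale klE0 (n - 1) ^ 2) : ℝ) : ℂ)‖ ≤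
      (17 * Real.exp 2 / 2) / klScale klE0 n ^ 2 * |s - s'|) ∧
    (∀ s, s ≤ (klScale klE0 n / 2) ^ 2 →
      ((salmhoferCutoff (s / klScale klE0 n ^ 2) - salmhoferCutoff (s / klScale klE0 (n - 1) ^ 2) : ℝ) : ℂ) = 0) ∧
    (∀ s, (4 * klScale klE0 n) ^ 2 ≤ s →
      ((salmhoferCutoff (s / klScale klE0 n ^ 2) - salmhoferCutoff (s / klScale klE0 (n - 1) ^ 2) : ℝ) : ℂ) = 0) := by
  have hΛ := klth_klScale_pos n
  have hprev : klScale klE0 (n - 1) = 4 * klScale klE0 n := by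
    obtain ⟨m, rfl⟩ : ∃ m, n = m + 1 := ⟨n - 1, by omega⟩
    rw [Nat.add_sub_cancel, klth_klScale_succ]; ring
  rw [hprev]
  exact ⟨fun s => klwt_norm_le _ _ s, fun s s' => klwt_lipschitz_scale hΛ s s', fun s hs => klwt_zero_of_le hΛ s hs,
    fun s hs => klwt_zero_of_ge hΛ s hs⟩

/-! ## The weight PRODUCTS (zero-transfer part: `F = w_n·w_n` and the cross pair `F = w_n·w_{n−1}`) -/

/-- Product rule for Lipschitz weights: if `‖f‖ ≤ M`, `‖f'‖ ≤ M'`, `f` is `L`-Lipschitz and `f'` is `L'`-Lipschitz then `f·f'` is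
`(M·L' + M'·L)`-Lipschitz. -/
theorem klwt_mul_lipschitz {f f' : ℝ → ℂ} {M M' L L' : ℝ} (hbd : ∀ s, ‖f s‖ ≤ M) (hbd' : ∀ s, ‖f' s‖ ≤ M')
    (hlip : ∀ s s', ‖f s - f s'‖ ≤ L * |s - s'|) (hlip' : ∀ s s', ‖f' s - f' s'‖ ≤ L' * |s - s'|) (s s' : ℝ) :
    ‖f s * f' s - f s' * f' s'‖ ≤ (M * L' + M' * L) * |s - s'| := by
  have hM : 0 ≤ M := (norm_nonneg _).trans (hbd 0)
  have hM' : 0 ≤ M' := (norm_nonneg _).trans (hbd' 0)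
  have hsplit : f s * f' s - f s' * f' s' = f s * (f' s - f' s') + (f s - f s') * f' s' := by ring
  rw [hsplit]
  calc ‖f s * (f' s - f' s') + (f s - f s') * f' s'‖ ≤ ‖f s * (f' s - f' s')‖ + ‖(f s - f s') * f' s'‖ := norm_add_le _ _
    _ = ‖f s‖ * ‖f' s - f' s'‖ + ‖f s - f s'‖ * ‖f' s'‖ := by rw [norm_mul, norm_mul]
    _ ≤ M * (L' * |s - s'|) + L * |s - s'| * M' :=
        add_le_add (mul_le_mul (hbd s) (hlip' s s') (norm_nonneg _) hM) (mul_le_mul (hlip s s') (hbd' s') (norm_nonneg _)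
          (le_trans (norm_nonneg _) (hlip s s')))
    _ = (M * L' + M' * L) * |s - s'| := by ring

/-- Product of two weights bounded by `M`, `M'`: `‖f·f'‖ ≤ M·M'`. -/
theorem klwt_mul_norm_le {f f' : ℝ → ℂ} {M M' : ℝ} (hbd : ∀ s, ‖f s‖ ≤ M) (hbd' : ∀ s, ‖f' s‖ ≤ M') (s : ℝ) :
    ‖f s * f' s‖ ≤ M * M' := by
  rw [norm_mul]
  exact mul_le_mul (hbd s) (hbd' s) (norm_nonneg _) ((norm_nonneg _).trans (hbd 0))

/-- **The same-slice weight product `F = w_n·w_n`** meets the `F`-hypotheses of `klte_slice_bubble_weighted_norm_le` /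
`klsp_slice_bubble_transfer_norm_le` with `M_F = 1`, `ℓ_F = 17e²` (`n ≥ 1`). -/
theorem klwt_sliceWeightSq_hypotheses {n : ℕ} (hn : 1 ≤ n) :
    (∀ s, ‖((salmhoferCutoff (s / klScale klE0 n ^ 2) - salmhoferCutoff (s / klScale klE0 (n - 1) ^ 2) : ℝ) : ℂ) *
        ((salmhoferCutoff (s / klScale klE0 n ^ 2) - salmhoferCutoff (s / klScale klE0 (n - 1) ^ 2) : ℝ) : ℂ)‖ ≤ 1) ∧
    (∀ s s', ‖((salmhoferCutoff (s / klScale klE0 n ^ 2) - salmhoferCutoff (s / klScale klE0 (n - 1) ^ 2) : ℝ) : ℂ) *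
          ((salmhoferCutoff (s / klScale klE0 n ^ 2) - salmhoferCutoff (s / klScale klE0 (n - 1) ^ 2) : ℝ) : ℂ) -
        ((salmhoferCutoff (s' / klScale klE0 n ^ 2) - salmhoferCutoff (s' / klScale klE0 (n - 1) ^ 2) : ℝ) : ℂ) *
          ((salmhoferCutoff (s' / klScale klE0 n ^ 2) - salmhoferCutoff (s' / klScale klE0 (n - 1) ^ 2) : ℝ) : ℂ)‖ ≤
      (17 * Real.exp 2) / klScale klE0 n ^ 2 * |s - s'|) := by
  obtain ⟨hb, hl, -, -⟩ := klwt_sliceWeight_hypotheses hn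
  refine ⟨fun s => ?_, fun s s' => ?_⟩
  · have := klwt_mul_norm_le hb hb s
    simpa using this
  · refine (klwt_mul_lipschitz hb hb hl hl s s').trans (le_of_eq ?_)
    ring

/-! ## Sharp constants (`|χ₂′| ≤ 32/3`): `ℓ = 34/3 < 12` -/

/-- Lipschitz in `s` with the sharper cutoff bound: `‖w(s) − w(s')‖ ≤ (32/3)·(1/Λ² + 1/Λ′²)·|s − s'|`. -/
theorem klwt_lipschitz_sharp {Λ Λ' : ℝ} (hΛ : Λ ≠ 0) (hΛ' : Λ' ≠ 0) (s s' : ℝ) :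
    ‖((salmhoferCutoff (s / Λ ^ 2) - salmhoferCutoff (s / Λ' ^ 2) : ℝ) : ℂ) -
        ((salmhoferCutoff (s' / Λ ^ 2) - salmhoferCutoff (s' / Λ' ^ 2) : ℝ) : ℂ)‖ ≤
      32 / 3 * ((Λ ^ 2)⁻¹ + (Λ' ^ 2)⁻¹) * |s - s'| := by
  rw [← Complex.ofReal_sub, Complex.norm_real, Real.norm_eq_abs]
  have h1 := klcd_lipschitz_salmhoferCutoff_sharp (s / Λ ^ 2) (s' / Λ ^ 2)
  have h2 := klcd_lipschitz_salmhoferCutoff_sharp (s / Λ' ^ 2) (s' / Λ' ^ 2)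
  have hΛ2 : 0 < Λ ^ 2 := by positivity
  have hΛ'2 : 0 < Λ' ^ 2 := by positivity
  have e1 : |s / Λ ^ 2 - s' / Λ ^ 2| = (Λ ^ 2)⁻¹ * |s - s'| := by
    rw [← sub_div, abs_div, abs_of_pos hΛ2]; ring
  have e2 : |s / Λ' ^ 2 - s' / Λ' ^ 2| = (Λ' ^ 2)⁻¹ * |s - s'| := by
    rw [← sub_div, abs_div, abs_of_pos hΛ'2]; ring
  rw [e1] at h1
  rw [e2] at h2
  calc |salmhoferCutoff (s / Λ ^ 2) - salmhoferCutoff (s / Λ' ^ 2) - (salmhoferCutoff (s' / Λ ^ 2) - salmhoferCutoff (s' / Λ' ^ 2))|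
      = |(salmhoferCutoff (s / Λ ^ 2) - salmhoferCutoff (s' / Λ ^ 2)) - (salmhoferCutoff (s / Λ' ^ 2) - salmhoferCutoff (s' / Λ' ^ 2))| := by
        ring_nf
    _ ≤ |salmhoferCutoff (s / Λ ^ 2) - salmhoferCutoff (s' / Λ ^ 2)| + |salmhoferCutoff (s / Λ' ^ 2) - salmhoferCutoff (s' / Λ' ^ 2)| :=
        abs_sub _ _
    _ ≤ 32 / 3 * ((Λ ^ 2)⁻¹ * |s - s'|) + 32 / 3 * ((Λ' ^ 2)⁻¹ * |s - s'|) := add_le_add h1 h2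
    _ = 32 / 3 * ((Λ ^ 2)⁻¹ + (Λ' ^ 2)⁻¹) * |s - s'| := by ring

/-- Scale form with the sharp constant: `‖w(s) − w(s')‖ ≤ ((34/3)/Λ²)·|s − s'|` for the slice `(Λ, 4Λ]` — `ℓ = 34/3 < 12`. -/
theorem klwt_lipschitz_scale_sharp {Λ : ℝ} (hΛ : 0 < Λ) (s s' : ℝ) :
    ‖((salmhoferCutoff (s / Λ ^ 2) - salmhoferCutoff (s / (4 * Λ) ^ 2) : ℝ) : ℂ) -
        ((salmhoferCutoff (s' / Λ ^ 2) - salmhoferCutoff (s' / (4 * Λ) ^ 2) : ℝ) : ℂ)‖ ≤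
      (34 / 3) / Λ ^ 2 * |s - s'| := by
  have h := klwt_lipschitz_sharp hΛ.ne' (by positivity : (4 * Λ) ≠ 0) s s'
  refine h.trans (le_of_eq ?_)
  field_simp
  ring

/-- **The carrier's slice weight with the sharp constants** (`n ≥ 1`): the four weight hypotheses with `M_f = 1`, `ℓ = 34/3`. -/
theorem klwt_sliceWeight_hypotheses_sharp {n : ℕ} (hn : 1 ≤ n) :
    (∀ s, ‖((salmhoferCutoff (s / klScale klE0 n ^ 2) - salmhoferCutoff (s / klScale klE0 (n - 1) ^ 2) : ℝ) : ℂ)‖ ≤ 1) ∧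
    (∀ s s', ‖((salmhoferCutoff (s / klScale klE0 n ^ 2) - salmhoferCutoff (s / klScale klE0 (n - 1) ^ 2) : ℝ) : ℂ) -
        ((salmhoferCutoff (s' / klScale klE0 n ^ 2) - salmhoferCutoff (s' / klScale klE0 (n - 1) ^ 2) : ℝ) : ℂ)‖ ≤
      (34 / 3) / klScale klE0 n ^ 2 * |s - s'|) ∧
    (∀ s, s ≤ (klScale klE0 n / 2) ^ 2 →
      ((salmhoferCutoff (s / klScale klE0 n ^ 2) - salmhoferCutoff (s / klScale klE0 (n - 1) ^ 2) : ℝ) : ℂ) = 0) ∧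
    (∀ s, (4 * klScale klE0 n) ^ 2 ≤ s →
      ((salmhoferCutoff (s / klScale klE0 n ^ 2) - salmhoferCutoff (s / klScale klE0 (n - 1) ^ 2) : ℝ) : ℂ) = 0) := by
  have hΛ := klth_klScale_pos n
  have hprev : klScale klE0 (n - 1) = 4 * klScale klE0 n := by
    obtain ⟨m, rfl⟩ : ∃ m, n = m + 1 := ⟨n - 1, by omega⟩
    rw [Nat.add_sub_cancel, klth_klScale_succ]; ring
  rw [hprev]
  exact ⟨fun s => klwt_norm_le _ _ s, fun s s' => klwt_lipschitz_scale_sharp hΛ s s', fun s hs => klwt_zero_of_le hΛ s hs,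
    fun s hs => klwt_zero_of_ge hΛ s hs⟩

/-- Product `F = w_n·w_n` with the sharp constant: `ℓ_F = 68/3 < 23`. -/
theorem klwt_sliceWeightSq_lipschitz_sharp {n : ℕ} (hn : 1 ≤ n) (s s' : ℝ) :
    ‖((salmhoferCutoff (s / klScale klE0 n ^ 2) - salmhoferCutoff (s / klScale klE0 (n - 1) ^ 2) : ℝ) : ℂ) *
          ((salmhoferCutoff (s / klScale klE0 n ^ 2) - salmhoferCutoff (s / klScale klE0 (n - 1) ^ 2) : ℝ) : ℂ) -
        ((salmhoferCutoff (s' / klScale klE0 n ^ 2) - salmhoferCutoff (s' / klScale klE0 (n - 1) ^ 2) : ℝ) : ℂ) *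
          ((salmhoferCutoff (s' / klScale klE0 n ^ 2) - salmhoferCutoff (s' / klScale klE0 (n - 1) ^ 2) : ℝ) : ℂ)‖ ≤
      (68 / 3) / klScale klE0 n ^ 2 * |s - s'| := by
  obtain ⟨hb, hl, -, -⟩ := klwt_sliceWeight_hypotheses_sharp hn
  refine (klwt_mul_lipschitz hb hb hl hl s s').trans (le_of_eq ?_)
  ring

end Summit.HubbardSuperconductivity.HubbardSuperconductivity.Theorems.KLRegimeSplit

end
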